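import Mathlib
import HarnessLib
import Summits.QuantumFields.YangMills.Theorems.ParabolicTrajectoryContinuumLimitOnTrajectoryDefsC
import Summits.QuantumFields.YangMills.Theorems.ComplexCouplingChannelContinuumLegGivenGapAlternatingArraysDefs
import Summits.QuantumFields.YangMills.Theorems.ComplexCouplingChannelContinuumLegGivenGapArrayFunctionalGrid
import Summits.QuantumFields.YangMills.Theorems.ComplexCouplingChannelContinuumLegGivenGapArrayFunctionalObs
import Summits.QuantumFields.YangMills.Theorems.ComplexCouplingChannelContinuumLegGivenGapArrayFunctionalPsi
import Literature.Probability.LatticeModels.ChessboardEstimateAssignments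

/-!
# `stub_arrayFunctional` — the Wilson reflection-positivity instance behind the chessboard estimate
# (crux `ContinuumLegGivenGap`, stmt-QuantumFields-15828, line `alternating-curvature-arrays`)

Registered stub of the line (VERBATIM signature).  For `0 ≤ β_k`, an admissible level `m` of the torus `2L_k+1`
(`N = numCells (L k) m = 2 (2L_k+1) / 3^m`, even), a grid offset `v`, `n` smeared plaquette fields with real test
functions `f i` supported in the cores of pairwise distinct cells `z i` of the central half-box, and the tensor test
function `F = ⊗ᵢ f i`, we produce the array functional `ψ = arrayPsi …` of `…ArrayFunctionalPsi` (Wilson expectation of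
the product over the blocks of the block torus `(ℤ/N)^4` of the mirror copies they carry), the block `e i` of the home
cell of the field `i` and the assignment `σ₀` placing field `i` in `e i` and the unit elsewhere, with:
(RP) reflection positivity and the reflection Cauchy–Schwarz inequality for every axis and block boundary
(`arrayPsi_rp`); (UNIT) `ψ (const none) = 1`; (MEAN) `ψ (const (some i)) = arrayMean (f i)`; `e` injective (distinct
cells of the central half-box are distinct mod `N`, `…ArrayFunctionalGrid.eq_of_cellInHalfBox_of_intCast_eq`);
and (TENSOR) `‖canonDistribution r sch k n (plaq ∘ q) F‖ = |ψ σ₀|`: on a tensor test function the canonical lattice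
distribution of the plaquette string factorises under the integral (`Fintype.prod_sum`) into the product of the smeared
fields, which are the mirror copies at their home cells (`cornerMap_self`), i.e. the blocks `e i` up to `N`-periodicity
(`arrayObs_congr_of_intCast_eq`).  References: J. Fröhlich, R. Israel, E. H. Lieb, B. Simon, Comm. Math. Phys. 62 (1978)
1, Thm. 2.2. [folklore]
-/

set_option autoImplicit false

noncomputable section

namespace Summit.QuantumFields.YangMills.Theorems.ContinuumLegGivenGap

open scoped SchwartzMap
open MeasureTheory
open Literature.MathematicalPhysics.QuantumFieldTheory Literature.MathematicalPhysics.QuantumLattice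
  Literature.MathematicalPhysics.AQFT Literature.Probability.LatticeModels
open Literature.Barriers.CriticalPhenomena.NonGibbs (BlockIdx)
open Summit.QuantumFields.YangMills.Cruxes.ContinuumLimitOnTrajectory.TwoOrbitSynchronisation
  (PlaqIdx plaq canonDistribution)
open Summit.QuantumFields.YangMills.Theorems.ContinuumLegGivenGap.AlternatingArrays

local notation "𝔼" => EuclideanSpace ℝ (Fin 4)

section Tensor

variable {G : Type} [Group G] [TopologicalSpace G] [IsTopologicalGroup G] [CompactSpace G]
  [MeasurableSpace G] [BorelSpace G]

/-- **(TENSOR) The canonical distribution of a plaquette string on a tensor test function** `F = ⊗ᵢ fᵢ` (real `fᵢ`)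
is the Wilson expectation of the product of the smeared fields, i.e. of the mirror copies at their home cells.
[folklore] -/
theorem canonDistribution_tensor_eq (r : LatticeRep G) (sch : SpeciesScheme (YMSpecies G)) (k m : ℕ)
    (v : Fin 4 → ℤ) {n : ℕ} (q : Fin n → PlaqIdx) (z : Fin n → Fin 4 → ℤ) (f : Fin n → 𝓢(𝔼, ℝ))
    {F : 𝓢((Fin n → 𝔼), ℂ)} (hF : IsTensorOf F (fun i => ofRealTest (f i))) :
    canonDistribution r sch k n (fun i => plaq r (q i)) F =
      ((∫ U, ∏ i, arrayObs r (sch.β k) (sch.a k) (sch.L k) m v (z i) (z i) (q i) (f i) U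
        ∂(wilsonMeasure (d := 4) (L := 2 * sch.L k + 1) r.ρ (sch.β k)) : ℝ) : ℂ) := by
  rw [show canonDistribution r sch k n (fun i => plaq r (q i)) F =
      ∫ U : GaugeConfig 4 (2 * sch.L k + 1) G, ∑ x : Fin n → ↥(box 4 (sch.L k)),
        F (fun i => sch.a k • siteToE (↑(x i) : Fin 4 → ℤ)) *
        ∏ i, ((plaquetteObs r.ρ 0 (q i).1.1 (q i).1.2 (configShift (-(↑(x i) : Fin 4 → ℤ))
            (torusLift (2 * sch.L k + 1) U)) -
          wilsonTorusMean r.ρ (sch.β k) (sch.L k) (plaquetteObs r.ρ 0 (q i).1.1 (q i).1.2) : ℝ) : ℂ)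
      ∂(wilsonMeasure (d := 4) (L := 2 * sch.L k + 1) r.ρ (sch.β k)) from rfl, ← integral_complex_ofReal]
  refine integral_congr_ae (ae_of_all _ fun U => ?_)
  -- the summand as a product over the fields
  set g : Fin n → ↥(box 4 (sch.L k)) → ℂ := fun i y =>
    ((f i (sch.a k • siteToE (↑y : Fin 4 → ℤ)) *
      (plaquetteObs r.ρ 0 (q i).1.1 (q i).1.2 (configShift (-(↑y : Fin 4 → ℤ)) (torusLift (2 * sch.L k + 1) U)) -
        wilsonTorusMean r.ρ (sch.β k) (sch.L k) (plaquetteObs r.ρ 0 (q i).1.1 (q i).1.2)) : ℝ) : ℂ) with hg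
  calc ∑ x : Fin n → ↥(box 4 (sch.L k)), F (fun i => sch.a k • siteToE (↑(x i) : Fin 4 → ℤ)) *
        ∏ i, ((plaquetteObs r.ρ 0 (q i).1.1 (q i).1.2 (configShift (-(↑(x i) : Fin 4 → ℤ))
            (torusLift (2 * sch.L k + 1) U)) -
          wilsonTorusMean r.ρ (sch.β k) (sch.L k) (plaquetteObs r.ρ 0 (q i).1.1 (q i).1.2) : ℝ) : ℂ)
      = ∑ x : Fin n → ↥(box 4 (sch.L k)), ∏ i, g i (x i) := by
        refine Finset.sum_congr rfl fun x _ => ?_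
        rw [hF, ← Finset.prod_mul_distrib]
        refine Finset.prod_congr rfl fun i _ => ?_
        rw [hg]
        beta_reduce
        rw [ofRealTest_apply, Complex.ofReal_mul]
    _ = ∏ i, ∑ y : ↥(box 4 (sch.L k)), g i y := (Fintype.prod_sum g).symm
    _ = ((∏ i, arrayObs r (sch.β k) (sch.a k) (sch.L k) m v (z i) (z i) (q i) (f i) U : ℝ) : ℂ) := by
        rw [Complex.ofReal_prod]
        refine Finset.prod_congr rfl fun i _ => ?_
        rw [arrayObs, Complex.ofReal_sum, ← Finset.sum_coe_sort (box 4 (sch.L k))]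
        refine Finset.sum_congr rfl fun y _ => ?_
        rw [hg, cornerMap_self]

end Tensor

/-- `stub_arrayFunctional` — **the Wilson reflection-positivity instance behind the chessboard estimate** (size L).
For `0 ≤ β_k`, an admissible level `m` (so `numCells = N = 2 × odd ≥ 6`), a lattice offset `v`, `n` smeared
plaquette fields `Φᵢ = Φ_{qᵢ}(fᵢ)` with real `fᵢ` supported in the CORES of pairwise distinct level-`m` cells `zᵢ` of the
central half-box, and `F = ⊗ᵢ fᵢ`: there is a real functional `ψ` of assignments `σ : BlockIdx 4 N → Option (Fin n)`
— `ψ σ = ∫ ∏_c obs(σ c, c) dμ_{β_k}`, `obs(none, c) = 1`, `obs(some i, c) = arrayObs … (z i) (rep c) (q i) (f i)`,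
`rep c = (c_μ.val)_μ` (`arrayPsi`) — such that: (RP) for every axis `μ` and wall `k`, `0 ≤ ψ (asgSymP μ k σ)`,
`0 ≤ ψ (asgSymM μ k σ)` and `ψ σ ^ 2 ≤ ψ (asgSymP μ k σ) * ψ (asgSymM μ k σ)` (`arrayPsi_rp`: each wall reflection of the
odd torus is a translate and axis permute of the tree's mixed reflection `t ↦ 1 - t`, for which Wilson's measure is RP;
fields supported in cores of cells of `H₊` depend only on positive-half links; the transport is reflection-covariant);
(UNIT) `ψ (const none) = 1`; (MEAN) `ψ (const (some i)) = arrayMean(fᵢ)`; (TENSOR) for the assignment `σ₀` placing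
field `i` in the block `e i` of its home cell (`e` injective since distinct half-box cells are distinct mod `N`) and
`none` elsewhere, `‖canonDistribution r sch k n (plaq ∘ q) F‖ = |ψ σ₀|`.  [folklore] -/
theorem stub_arrayFunctional :
    ∀ (G : Type) [Group G] [TopologicalSpace G] [IsTopologicalGroup G] [CompactSpace G]
      [MeasurableSpace G] [BorelSpace G] (r : LatticeRep G) (sch : SpeciesScheme (YMSpecies G)) (k m : ℕ),
      0 ≤ sch.β k → LevelAdmissible (sch.L k) m →
      ∀ (v : Fin 4 → ℤ) (n : ℕ) (q : Fin n → PlaqIdx) (z : Fin n → (Fin 4 → ℤ)) (f : Fin n → 𝓢(𝔼, ℝ))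
        (F : 𝓢((Fin n → 𝔼), ℂ)),
        (∀ i, CellInHalfBox (sch.L k) m v (z i)) → Function.Injective z →
        (∀ i, tsupport (f i) ⊆ physCore (sch.a k) m v (z i)) → IsTensorOf F (fun i => ofRealTest (f i)) →
        ∀ (N : ℕ) [NeZero N], numCells (sch.L k) m = N →
        ∃ (ψ : (Literature.Barriers.CriticalPhenomena.NonGibbs.BlockIdx 4 N → Option (Fin n)) → ℝ)
          (e : Fin n → Literature.Barriers.CriticalPhenomena.NonGibbs.BlockIdx 4 N)
          (σ₀ : Literature.Barriers.CriticalPhenomena.NonGibbs.BlockIdx 4 N → Option (Fin n)),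
          (∀ (μ : Fin 4) (c : ZMod N) (σ : Literature.Barriers.CriticalPhenomena.NonGibbs.BlockIdx 4 N → Option (Fin n)),
            0 ≤ ψ (asgSymP μ c σ) ∧ 0 ≤ ψ (asgSymM μ c σ) ∧
              ψ σ ^ 2 ≤ ψ (asgSymP μ c σ) * ψ (asgSymM μ c σ)) ∧
          ψ (fun _ => none) = 1 ∧
          (∀ i, ψ (fun _ => some i) = arrayMean r (sch.β k) (sch.a k) (sch.L k) m v (z i) (q i) (f i)) ∧
          Function.Injective e ∧ (∀ i, σ₀ (e i) = some i) ∧ (∀ c, (∀ i, e i ≠ c) → σ₀ c = none) ∧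
          ‖canonDistribution r sch k n (fun i => plaq r (q i)) F‖ = |ψ σ₀| := by
  intro G _ _ _ _ _ _ r sch k m hβ hm v n q z f F hbox hz hf hF N _ hNc
  classical
  -- the admissible level: `3^m N = 2 (2L+1)`, `N` even, `L ≥ 1`
  obtain ⟨hmul, hNe, h6⟩ := numCells_spec hm
  have hPN : (3 : ℤ) ^ m * N = 2 * ((2 * sch.L k + 1 : ℕ) : ℤ) := by rw [← hNc]; exact_mod_cast hmul
  have hN : Even N := hNc ▸ hNe
  have hL : 1 ≤ sch.L k := by
    have h1 : numCells (sch.L k) m ≤ 3 ^ m * numCells (sch.L k) m :=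
      Nat.le_mul_of_pos_left _ (Nat.one_le_pow _ _ (by norm_num))
    omega
  -- the blocks of the home cells and the assignment `σ₀`
  let e : Fin n → BlockIdx 4 N := fun i μ => ((z i μ : ℤ) : ZMod N)
  have he : Function.Injective e := fun i j hij =>
    hz (funext fun μ => eq_of_cellInHalfBox_of_intCast_eq hPN (hbox i) (hbox j) (congrFun hij μ))
  let σ₀ : BlockIdx 4 N → Option (Fin n) := fun c => if h : ∃ j, e j = c then some h.choose else none
  have hσe : ∀ i, σ₀ (e i) = some i := fun i => by
    have h : ∃ j, e j = e i := ⟨i, rfl⟩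
    show (if h : ∃ j, e j = e i then some h.choose else none) = some i
    rw [dif_pos h, he h.choose_spec]
  have hσ0 : ∀ c, (∀ i, e i ≠ c) → σ₀ c = none := fun c hc => dif_neg fun ⟨i, hi⟩ => hc i hi
  refine ⟨arrayPsi r (sch.β k) (sch.a k) (sch.L k) m v z q f, e, σ₀,
    fun μ c σ => arrayPsi_rp r hPN hN hL hβ (sch.a_pos k) v q hf μ c σ,
    arrayPsi_const_none r _ _ _ m v z q f, fun i => arrayPsi_const_some r _ _ _ m v z q f hNc i, he, hσe, hσ0, ?_⟩
  -- (TENSOR)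
  have hpsi : arrayPsi r (sch.β k) (sch.a k) (sch.L k) m v z q f σ₀ =
      ∫ U, ∏ i, arrayObs r (sch.β k) (sch.a k) (sch.L k) m v (z i) (z i) (q i) (f i) U
        ∂(wilsonMeasure (d := 4) (L := 2 * sch.L k + 1) r.ρ (sch.β k)) := by
    unfold arrayPsi
    refine integral_congr_ae (ae_of_all _ fun U => ?_)
    beta_reduce
    have himg : ∀ c ∈ (Finset.univ : Finset (BlockIdx 4 N)), c ∉ Finset.univ.image e →
        blockObs r (sch.β k) (sch.a k) (sch.L k) m v z q f (σ₀ c) c U = 1 := fun c _ hc => by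
      rw [hσ0 c fun i h => hc (Finset.mem_image.2 ⟨i, Finset.mem_univ _, h⟩)]; rfl
    rw [← Finset.prod_subset (Finset.subset_univ (Finset.univ.image e)) himg,
      Finset.prod_image fun i _ j _ h => he h]
    refine Finset.prod_congr rfl fun i _ => ?_
    rw [hσe i, blockObs_some]
    refine congrFun (arrayObs_congr_of_intCast_eq r (sch.β k) (sch.a k) hPN hN v (z i) (fun μ => ?_) (q i) (f i)) U
    show (((((z i μ : ℤ) : ZMod N)).val : ℤ) : ZMod N) = ((z i μ : ℤ) : ZMod N)
    rw [Int.cast_natCast, ZMod.natCast_zmod_val]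
  rw [canonDistribution_tensor_eq r sch k m v q z f hF, Complex.norm_real, Real.norm_eq_abs, hpsi]

end Summit.QuantumFields.YangMills.Theorems.ContinuumLegGivenGap

end
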